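import Summits.ResolutionOfSingularities.ResolutionOfSingularities.Theorems.AbsoluteQFrameField
import HarnessLib

/-!
# AbsoluteQFrameCount — decomp-res node «AbsoluteContactInsep» (lens-6 g18), tree file 8/10 of the node

Content VERBATIM from the decomp-res lens-6 g18 file `HOME/decomp-res-lens-6/g18/AbsoluteContactInsep.lean` (sha256
3771488be5d3cd2c, 1966 l; HOME =
run/shared/lean/pub/decomp-res).  Critic: CRITIC-LEDGER row 139 (CLEARED 2026-08-30T20:11:48Z, DECIDED +1:
`AbsContactOff3` proved for every p ≠ 3 and every
field, hypothesis-free); split per the lens's NODE-g18 §8 writer package (sections kept whole; two packages halved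
for the 400-line limit).  Landed by
decomp-res writer g7 in the lens's namespace `…Theorems.AbsoluteContactClasses` (cone-free chain); the wiring
`Theorems/MaxContactCutAbsContactOff3`
(`agAbsContactOff3 : AGAbsContactOff3`, item 27752) follows the chain.  No new aside, nothing superseded; asides
31574 / 27753 / 27896 are ⟺ each other
hypothesis-free by this node.

Section `FieldLayerCount` (l. 1653–1799).

[WRITER NOTE (decomp-res writer g7): file split only; namespace, opens, section variables and every declaration
exactly as in the lens (global `set_option` dropped).]

(Sources: Giraud1975; EGA IV 16.11.2, 0_IV 21.9; KimuraNiitsuma1980 Thm 3.4; EncinasVillamayor2000 Thm 4.9;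
BravoGarciaEscamillaVillamayor2012 Lemma 4.6; Hironaka1964; CossartJannsenSaito2020; CossartPiltant2019; Kunz1969.)
-/

noncomputable section

open CategoryTheory AlgebraicGeometry TopologicalSpace
open Literature.AlgebraicGeometry.Resolution
open Summit.ResolutionOfSingularities.ResolutionOfSingularities.Theorems
open WeakOrderReduction ForcedTowerClasses PurityValveClasses
open SatelliteExitClasses
open IsLocalRing MvPolynomial

namespace Summit.ResolutionOfSingularities.ResolutionOfSingularities.Theorems.AbsoluteContactClasses

section FieldLayerCount

/-! ### The count lemma: `k` is finitely generated over `k^{p^e}[Λ₀]` -/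

variable {K : Type*} [Field K] (p : ℕ) [Fact p.Prime] [CharP K p]

/-- **Count lemma (level `p`)**: if `k̄ ⊆ K^p(Λ)` with `Λ ⊆ k̄` and `[K : k] < ∞`, then `k` is a
finitely generated module over `k^p[Λ₀]`, `Λ₀ = κ⁻¹Λ` (`k̄ ⊆ K^p[Λ] ⊆ span_{κ(k^p[Λ₀])}(S^p)` for
a `k`-spanning set `S` of `K`, a finite-dimensional space over the field `κ(k^p[Λ₀])`). [folklore] -/
theorem exists_finset_span_pcl (k : Type*) [Field k] [Algebra k K] [Module.Finite k K]
    {Λ : Set K} (hΛk : Λ ⊆ Set.range (algebraMap k K))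
    (hgen : ∀ a : k, algebraMap k K a ∈ IntermediateField.adjoin (↥(frobenius K p).fieldRange) Λ) :
    ∃ M : Finset k, ∀ a : k, a ∈ Submodule.span (↥(pcl (p ^ 1) ((algebraMap k K) ⁻¹' Λ))) (M : Set k) := by
  classical
  have hp : p.Prime := Fact.out
  set κ := algebraMap k K with hκ
  have hκi : Function.Injective κ := κ.injective
  set Λ₀ : Set k := κ ⁻¹' Λ with hΛ₀
  set P : Subfield k := pclField (pow_pos hp.pos 1) Λ₀ with hP
  set F₀ : Subfield K := P.map κ with hF₀
  obtain ⟨S, hS⟩ := Module.Finite.fg_top (R := k) (M := K)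
  let W : Submodule (↥F₀) K := Submodule.span (↥F₀) ((S.image (frobenius K p) : Finset K) : Set K)
  have hpowW : ∀ x : K, x ^ p ∈ W := by
    intro x
    have hx : x ∈ Submodule.span k (S : Set K) := by rw [hS]; exact Submodule.mem_top
    obtain ⟨f, -, hf⟩ := Submodule.mem_span_finset.mp hx
    rw [← hf, ← frobenius_def, map_sum]
    refine Submodule.sum_mem _ fun a ha => ?_
    rw [Algebra.smul_def, map_mul, frobenius_def, ← map_pow]
    have hmem : κ (f a ^ p) ∈ F₀ := by
      refine Subfield.mem_map.mpr ⟨f a ^ p, ?_, rfl⟩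
      rw [hP, mem_pclField_iff, show (f a) ^ p = (f a) ^ (p ^ 1) by rw [pow_one]]
      exact pow_mem_pcl _ Λ₀ (f a)
    have : κ (f a ^ p) * frobenius K p a = (⟨κ (f a ^ p), hmem⟩ : ↥F₀) • frobenius K p a := rfl
    rw [this]
    exact Submodule.smul_mem _ _ (Submodule.subset_span (Finset.mem_coe.mpr (Finset.mem_image_of_mem _ ha)))
  have hclW : ∀ y ∈ pcl p Λ, ∀ w ∈ W, y * w ∈ W := by
    refine closure_mul_span_le' _ _ ?_
    rintro g (⟨z, -, rfl⟩ | hg) m hm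
    · obtain ⟨a, -, rfl⟩ := Finset.mem_image.mp (Finset.mem_coe.mp hm)
      show z ^ p * frobenius K p a ∈ W
      rw [frobenius_def, ← mul_pow]; exact hpowW _
    · obtain ⟨l0, hl⟩ := hΛk hg
      have hl0 : l0 ∈ Λ₀ := by rw [hΛ₀, Set.mem_preimage, hl]; exact hg
      have hgF : g ∈ F₀ := Subfield.mem_map.mpr ⟨l0, (mem_pclField_iff _ _ _).mpr (mem_pcl_of_mem hl0), hl⟩
      have : g * m = (⟨g, hgF⟩ : ↥F₀) • m := rfl
      rw [this]; exact Submodule.smul_mem _ _ (Submodule.subset_span hm)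
  have hkW : ∀ a : k, κ a ∈ W := fun a => by
    have h1 : (1 : K) ∈ W := by simpa using hpowW 1
    have := hclW (κ a) (mem_pcl_of_mem_adjoin p Λ (hgen a)) 1 h1
    rwa [mul_one] at this
  -- `k̄` as an `F₀`-submodule of `K`, inside the finite-dimensional `W`
  let V : Submodule (↥F₀) K :=
    { carrier := Set.range κ
      add_mem' := by rintro _ _ ⟨a, rfl⟩ ⟨b, rfl⟩; exact ⟨a + b, map_add κ a b⟩
      zero_mem' := ⟨0, map_zero κ⟩
      smul_mem' := by
        rintro c _ ⟨a, rfl⟩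
        obtain ⟨c0, -, hc0⟩ := Subfield.mem_map.mp c.2
        refine ⟨c0 * a, ?_⟩
        rw [map_mul, hc0]; rfl }
  have hVW : V ≤ W := by rintro _ ⟨a, rfl⟩; exact hkW a
  haveI : FiniteDimensional (↥F₀) W := FiniteDimensional.span_of_finite _ (Finset.finite_toSet _)
  haveI : FiniteDimensional (↥F₀) V := Submodule.finiteDimensional_of_le hVW
  obtain ⟨MV, hMV⟩ := Module.Finite.iff_fg.mp (inferInstance : Module.Finite (↥F₀) V)
  have hMVsub : ∀ m ∈ MV, m ∈ Set.range κ := fun m hm => by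
    have : m ∈ V := hMV ▸ Submodule.subset_span hm
    exact this
  let M : Finset k := MV.preimage κ hκi.injOn
  refine ⟨M, fun a => ?_⟩
  have haV : κ a ∈ Submodule.span (↥F₀) (MV : Set K) := by rw [hMV]; exact ⟨a, rfl⟩
  obtain ⟨f, -, hf⟩ := Submodule.mem_span_finset.mp haV
  have hfP : ∀ m : K, ∃ g ∈ P, κ g = (f m : K) := fun m => Subfield.mem_map.mp (f m).2
  choose g hgP hgκ using hfP
  have hsum : κ (∑ m ∈ M, g (κ m) * m) = κ a := by
    rw [map_sum, ← hf]
    simp only [map_mul, hgκ, Subfield.smul_def, smul_eq_mul]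
    exact Finset.sum_preimage κ MV hκi.injOn (fun m => (f m : K) * m)
      (fun m hm hnot => absurd (hMVsub m hm) hnot)
  rw [← hκi hsum]
  refine Submodule.sum_mem _ fun m hm => ?_
  have : g (κ m) * m = (⟨g (κ m), (mem_pclField_iff _ _ _).mp (hgP (κ m))⟩ : ↥(pcl (p ^ 1) Λ₀)) • m := rfl
  rw [this]
  exact Submodule.smul_mem _ _ (Submodule.subset_span (Finset.mem_coe.mpr hm))

open Pointwise in
/-- Level change for the count lemma: finite generation of `k` over `k^p[Λ₀]` implies finite
generation over `k^{p^{e+1}}[Λ₀]` (`M_{e+1} = M₁^{p^{e}} · M_e`). [folklore] -/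
theorem exists_finset_span_pcl_pow (k : Type*) [Field k] [CharP k p] (Λ₀ : Set k) (M₁ : Finset k)
    (h₁ : ∀ a : k, a ∈ Submodule.span (↥(pcl (p ^ 1) Λ₀)) (M₁ : Set k)) :
    ∀ e : ℕ, ∃ M : Finset k, ∀ a : k, a ∈ Submodule.span (↥(pcl (p ^ (e + 1)) Λ₀)) (M : Set k) := by
  classical
  have hp : p.Prime := Fact.out
  intro e
  induction e with
  | zero => exact ⟨M₁, h₁⟩
  | succ e ih =>
    obtain ⟨M, hM⟩ := ih
    set P' : Subring k := pcl (p ^ (e + 1 + 1)) Λ₀ with hP'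
    let W : Submodule (↥P') k := Submodule.span (↥P') ((M₁.image fun m => m ^ p ^ (e + 1) : Finset k) : Set k)
    -- (u1) all `p^{e+1}`-th powers lie in `W`
    have hpowW : ∀ y : k, y ^ p ^ (e + 1) ∈ W := by
      intro y
      obtain ⟨f, -, hf⟩ := Submodule.mem_span_finset.mp (h₁ y)
      rw [← hf, sum_pow_char_pow' p (e + 1)]
      refine Submodule.sum_mem _ fun m hm => ?_
      rw [Subring.smul_def, smul_eq_mul, mul_pow]
      have hc : (f m : k) ^ p ^ (e + 1) ∈ P' := by
        have h0 : (f m : k) ^ p ^ (e + 1) ∈ Subring.map (iterateFrobenius k p (e + 1))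
            (Subring.closure ((fun y : k => y ^ p ^ 1) '' Set.univ ∪ Λ₀)) :=
          ⟨f m, (f m).2, iterateFrobenius_def ..⟩
        rw [RingHom.map_closure] at h0
        refine (Subring.closure_le.mpr ?_) h0
        rintro w ⟨v, (⟨a, -, rfl⟩ | hv), rfl⟩
        · show iterateFrobenius k p (e + 1) (a ^ p ^ 1) ∈ P'
          rw [iterateFrobenius_def, ← pow_mul, ← pow_add, show 1 + (e + 1) = e + 1 + 1 by ring]
          exact pow_mem_pcl _ Λ₀ a
        · show iterateFrobenius k p (e + 1) v ∈ P'
          rw [iterateFrobenius_def]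
          exact pow_mem (mem_pcl_of_mem hv) _
      have : (f m : k) ^ p ^ (e + 1) * m ^ p ^ (e + 1) =
          (⟨(f m : k) ^ p ^ (e + 1), hc⟩ : ↥P') • m ^ p ^ (e + 1) := rfl
      rw [this]
      exact Submodule.smul_mem _ _ (Submodule.subset_span
        (Finset.mem_coe.mpr (Finset.mem_image_of_mem (fun m => m ^ p ^ (e + 1)) hm)))
    -- (u2) `k^{p^{e+1}}[Λ₀] · W ⊆ W`
    have hclW : ∀ c ∈ pcl (p ^ (e + 1)) Λ₀, ∀ w ∈ W, c * w ∈ W := by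
      refine closure_mul_span_le' _ _ ?_
      rintro g (⟨z, -, rfl⟩ | hg) w hw
      · obtain ⟨m, -, rfl⟩ := Finset.mem_image.mp (Finset.mem_coe.mp hw)
        show z ^ p ^ (e + 1) * m ^ p ^ (e + 1) ∈ W
        rw [← mul_pow]; exact hpowW _
      · have : g * w = (⟨g, mem_pcl_of_mem hg⟩ : ↥P') • w := rfl
        rw [this]; exact Submodule.smul_mem _ _ (Submodule.subset_span hw)
    -- (u3) conclude
    refine ⟨M₁.image (fun m => m ^ p ^ (e + 1)) * M, fun a => ?_⟩
    obtain ⟨f, -, hf⟩ := Submodule.mem_span_finset.mp (hM a)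
    rw [← hf, Finset.coe_mul, ← Submodule.span_mul_span]
    refine Submodule.sum_mem _ fun m hm => ?_
    rw [Subring.smul_def, smul_eq_mul]
    refine Submodule.mul_mem_mul ?_ (Submodule.subset_span (Finset.mem_coe.mpr hm))
    have h1 : (1 : k) ∈ W := by simpa using hpowW 1
    have := hclW (f m : k) (f m).2 1 h1
    rwa [mul_one] at this

end FieldLayerCount

end Summit.ResolutionOfSingularities.ResolutionOfSingularities.Theorems.AbsoluteContactClasses
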